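import Summits.Ventures.Crystal3D.Kissing125.GSearchRoot4
import Summits.Ventures.Crystal3D.Kissing125.GSearchBridge
import Summits.Ventures.Crystal3D.Kissing125.Geometry4
import Summits.Ventures.Crystal3D.Kissing125.SearchFinalA
import Summits.Ventures.Crystal3D.Kissing125.SearchFinalB
import Summits.Ventures.Crystal3D.Kissing125.SearchFinalC
import Summits.Ventures.Crystal3D.Kissing125.SearchFinalD
import HarnessLib

/-!
# The run of the growth search at `κ = 7/32`: assembly; `KConf.concl` for `KConf κ25` (V4′); BIMODAL(5/4)

HONEST FRAMING (cell pub-crystal3d, K-path at `h = 5/4`, V4′ layout): this file ASSEMBLES the 256 landed run parts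
`checkPart_eq_true_NNN : Kissing125.KissingSearch.checkPart 5 256 NNN 60 = true` (by `native_decide`, one axiom
`Lean.ofReduceBool` use each) through `SearchFinalA–D`, transports them to the κ-generic checker by the bridge
`GSearch.checkPart_κ25`, applies the κ-generic soundness theorem `GSearch.concl_of_parts` at `κ25 = ⟨7/32, …⟩`, reads the
K25 structure `KissingSearch.KConf` of `SearchDefs1` (κ₀ = 7/32 built in) as a `GSearch.KConf GSearch.κ25` FIELD BY FIELD
(`KissingSearch.KConf.concl_of_gsearch`; the one κ-dependent field `dichot` along `GSearch.κR_κ25 : κR κ25 = κ0R`, which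
holds by `rfl`), and feeds the LANDED K25 dictionary/rigidity `Geometry1–4` UNCHANGED (`isArrangedIn_of_forall_concl25`
takes `∀ M : KissingSearch.KConf, M.Concl`).  V4′ differs from V4 only in this last point: no `Geometry3`/`Geometry4`
re-filing.  Nothing here is asserted about GAP(1.26) or any census.

## References
* T. C. Hales, arXiv:1209.6043 (2012), Theorem 3, Lemmas 8–10. [`Hales2012`]
-/

namespace Summit.Ventures.Crystal3D.Kissing125

open Literature.Geometry.DiscreteGeometry

namespace KissingSearch

/-- **All `256` parts of the run at `κ = 7/32` return `true`.** [cite: Hales2012, Theorem 3 and Lemma 8] -/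
theorem checkPart_all : ∀ i, i < 256 → checkPart 5 256 i 60 = true := by
  intro i hi
  rcases Nat.lt_or_ge i 64 with h | h
  · exact checkPart_range_000_064 i (Nat.zero_le i) h
  rcases Nat.lt_or_ge i 128 with h2 | h2
  · exact checkPart_range_064_128 i h h2
  rcases Nat.lt_or_ge i 192 with h3 | h3
  · exact checkPart_range_128_192 i h2 h3
  · exact checkPart_range_192_256 i h3 hi

end KissingSearch

namespace GSearch

/-- **Every abstract structure at `κ = 7/32` has the FCC or the HCP contact graph**: the κ-generic soundness theorem
`concl_of_parts` at `κ25`, fed with the 256 run parts of the LANDED checker through the bridge `checkPart_κ25`.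
[cite: Hales2012, Theorem 3 and Lemma 9] -/
theorem KConf.concl (M : KConf κ25) : M.Concl :=
  concl_of_parts (depth := 5) (parts := 256) (fuel := 60) (by norm_num)
    (fun i hi => by rw [checkPart_κ25]; exact KissingSearch.checkPart_all i hi) M

/-- `κR κ25` is the K25 constant `κ0R` of `SearchDefs1`: both unfold to `((7/32 : ℚ) : ℝ)`. [folklore] -/
theorem κR_κ25 : κR κ25 = KissingSearch.κ0R := rfl

end GSearch

namespace KissingSearch

/-- **The K25 structure `KissingSearch.KConf` (`SearchDefs1`, κ₀ = 7/32 built in) read as a generic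
`GSearch.KConf GSearch.κ25`.**  The two structures have the same fields; the only κ-dependent one, `dichot`, is
transported along `GSearch.κR_κ25`; `Concl` reads only the Gram entries `g`, so the generic conclusion IS the K25
conclusion.  With it the landed dictionary `isArrangedIn_of_forall_concl25 (h : ∀ M : KissingSearch.KConf, M.Concl)`
(`Geometry4.lean`) is consumed unchanged. [cite: Hales2012, Theorem 3 and Lemma 9] -/
theorem KConf.concl_of_gsearch (h : ∀ M' : GSearch.KConf GSearch.κ25, M'.Concl) (M : KConf) : M.Concl := by
  have hd : ∀ a b, a < 12 → b < 12 → a ≠ b → M.g a b = 1 / 2 ∨ (-1 ≤ M.g a b ∧ M.g a b ≤ GSearch.κR GSearch.κ25) := by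
    rw [GSearch.κR_κ25]; exact M.dichot
  exact h
    { g := M.g, T := M.T, ang := M.ang, g_symm := M.g_symm, mem_T := M.mem_T, card_T := M.card_T, two := M.two,
      contact_side := M.contact_side, dichot := hd, side_bound := M.side_bound, cdeg_le := M.cdeg_le,
      contacts_ge := M.contacts_ge, node := M.node, ang_nonneg := M.ang_nonneg, ang_le_pi := M.ang_le_pi,
      ang_zero := M.ang_zero, cos_law := M.cos_law, circum := M.circum, pairing := M.pairing, link := M.link,
      conn := M.conn, cover := M.cover }

end KissingSearch

/-- **BIMODAL(5/4), PROVED (computationally): every `V ∈ 𝒱(5/2)` — twelve points of `S²(2)`, pairwise distances `2`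
or `≥ 5/2` — is the image of `2·fccKissingPattern` or of `2·hcpKissingPattern` under a linear isometry of `ℝ³`.**
Hales's Theorem 3 + Lemmas 9–10 with the separation constant an explicit parameter, instantiated at `5/2` (`κ = 7/32`):
the run (landed `SearchRun000–255`), the κ-generic soundness of the search (`GSearch*`), the geometric dictionary and the
census at `7/32` (`Geometry*`, `Estimates*`, landed, unchanged), rigidity at `σ = 7/8`.  Axioms: standard + `Lean.ofReduceBool`.
[cite: Hales2012, Theorem 3 and Lemmas 9–10 (method; separation constant 5/2 instead of 2.52)] -/
theorem isArrangedIn_of_isKissingConfig25 {S : Set (EuclideanSpace ℝ (Fin 3))} (hS : IsKissingConfig25 S) :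
    IsArrangedIn S fccKissingPattern ∨ IsArrangedIn S hcpKissingPattern :=
  isArrangedIn_of_forall_concl25 (KissingSearch.KConf.concl_of_gsearch GSearch.KConf.concl) hS

end Summit.Ventures.Crystal3D.Kissing125
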